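import Summits.HubbardSuperconductivity.HubbardSuperconductivity.Theorems.WeakCouplingBCSWcbcsSsbToTorusLROWindowLatticeSums

/-!
# Line `birth` of crux `InfraredCompletion` (stmt-HubbardSuperconductivity-1321, route BcsKacWindow):
# the soft-window tail from the Goldstone shape WITH BACKGROUND (pure lattice arithmetic)

Skeleton v3 of the line replaces the pointwise relative Goldstone shape
`S_ψ(m) · |q_m| · L² ≤ A · S_ψ(0)` (v2, physically wrong: it omits the `Θ(1)` incoherent background
of the pair structure factor, which dominates `A · S_ψ(0) / (|q_m| L²)` at the top of the soft window
whenever the order `S_ψ(0)/L²` is `≪ Δ(U)`) by the shape WITH A FLAT BACKGROUND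
`S_ψ(m) · |q_m| · L² ≤ A · S_ψ(0) + B · |q_m| · L²`, i.e. `S_ψ(m) ≤ A S_ψ(0) / (|q_m| L²) + B`
(Anderson–Bogoliubov singularity relative to the condensate plus the incoherent background).
This file is the arithmetic half of that reshaping, for ANY Fock vector (no physics):

* `card_softWindow_le` — the number of nonzero labels `m ∈ (ℤ/Lℤ)²` with `|q_m|² ≤ ε²` is
  `≤ ε² L² / 3` (group by the sup-norm `j ∈ [1, εL/(2π)]`, `4(2j+1) ≤ 12j` labels per layer);
* `softWindowTail_of_shapeBg` — the shape with background on the window `|q_m|² ≤ ε²` sums to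
  `Σ_{m ≠ 0, |q_m|² ≤ ε²} S_ψ(m) ≤ 2Aε · S_ψ(0) + B ε² L²`
  (`Σ_{0<|q_m|<2ε} |q_m|⁻¹ ≤ 2ε L²`, the landed `latWindowSum_le`, plus the label count).

`S_ψ(m) = pairStructureFactor dWaveFormFactor L ψ m`, `|q_m|² = momentumNormSq L m`
(`PairFieldMomentum`). Folklore (lattice-sum bookkeeping of any infrared-bound argument,
Kennedy–Lieb–Shastry, PRL 61 (1988) 2582); no definition is introduced.
-/

noncomputable section

-- the mandated namespace `Summit.<Summit>.<Problem>.Theorems…` repeats `HubbardSuperconductivity`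
-- (single-problem summit, D-0017), which the `dupNamespace` linter flags on every declaration
set_option linter.dupNamespace false

namespace Summit.HubbardSuperconductivity.HubbardSuperconductivity.Theorems.InfraredCompletion

open Literature.MathematicalPhysics.QuantumLattice Literature.Probability.LatticeModels
open Summit.HubbardSuperconductivity.HubbardSuperconductivity.Theorems.WcbcsSsbToTorusLRO
  (one_le_latLinf latLinf_sq_le_momentumNormSq latSum_le_layers latWindowSum_le)

/-- **Label count of the punctured soft window.** For `ε > 0`, the number of nonzero labels
`m ∈ (ℤ/Lℤ)²` with `|q_m|² ≤ ε²` is at most `ε² L² / 3`: such a label has sup-norm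
`j ∈ [1, εL/(2π)]` (`|q_m|² ≥ (2π/L)² j²`), each layer holds `≤ 4(2j+1) ≤ 12 J` labels
(`J = ⌊εL/(2π)⌋`), so the count is `≤ 12 J² ≤ 3 ε² L² / π² ≤ ε² L² / 3`. [folklore] -/
theorem card_softWindow_le (L : ℕ) [NeZero L] (ε : ℝ) (hε : 0 < ε) :
    (((Finset.univ.filter
        fun m : Fin 2 → ZMod L => m ≠ 0 ∧ momentumNormSq L m ≤ ε ^ 2).card : ℕ) : ℝ) ≤
      ε ^ 2 * (L : ℝ) ^ 2 / 3 := by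
  have hL : (0 : ℝ) < (L : ℝ) := Nat.cast_pos.2 (Nat.pos_of_ne_zero (NeZero.ne L))
  have hπ := Real.pi_pos
  have hπ3 := Real.pi_gt_three
  set J : ℕ := ⌊ε * (L : ℝ) / (2 * Real.pi)⌋₊ with hJ
  set T : Finset (Fin 2 → ZMod L) :=
    Finset.univ.filter fun m : Fin 2 → ZMod L => m ≠ 0 ∧ momentumNormSq L m ≤ ε ^ 2 with hTdef
  have hT : ∀ m ∈ T, max (m 0).valMinAbs.natAbs (m 1).valMinAbs.natAbs ∈ Finset.Icc 1 J := by
    intro m hm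
    obtain ⟨hm0, hmε⟩ := (Finset.mem_filter.1 hm).2
    refine Finset.mem_Icc.2 ⟨one_le_latLinf hm0, Nat.le_floor ?_⟩
    have h1 : ((2 * Real.pi / (L : ℝ)) *
        ((max (m 0).valMinAbs.natAbs (m 1).valMinAbs.natAbs : ℕ) : ℝ)) ^ 2 ≤ ε ^ 2 := by
      rw [mul_pow]
      exact le_trans (latLinf_sq_le_momentumNormSq m) hmε
    have h2 : (2 * Real.pi / (L : ℝ)) *
        ((max (m 0).valMinAbs.natAbs (m 1).valMinAbs.natAbs : ℕ) : ℝ) ≤ ε :=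
      le_of_pow_le_pow_left₀ two_ne_zero hε.le h1
    rw [div_mul_eq_mul_div, div_le_iff₀ hL] at h2
    rw [le_div_iff₀ (by positivity)]
    linarith
  have hJle : (J : ℝ) ≤ ε * (L : ℝ) / (2 * Real.pi) := Nat.floor_le (by positivity)
  calc ((T.card : ℕ) : ℝ) = ∑ m ∈ T, (1 : ℝ) := by simp
    _ ≤ ∑ j ∈ Finset.Icc 1 J, (4 * (2 * (j : ℝ) + 1)) * 1 :=
        latSum_le_layers T (Finset.Icc 1 J) (fun _ => (1 : ℝ)) (fun _ => (1 : ℝ)) hT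
          (fun _ _ => zero_le_one) (fun _ _ => le_rfl)
    _ ≤ ∑ j ∈ Finset.Icc 1 J, 12 * (J : ℝ) := by
        refine Finset.sum_le_sum fun j hj => ?_
        obtain ⟨hj1, hjJ⟩ := Finset.mem_Icc.1 hj
        have hj1' : (1 : ℝ) ≤ j := by exact_mod_cast hj1
        have hjJ' : (j : ℝ) ≤ J := by exact_mod_cast hjJ
        linarith
    _ = (J : ℝ) * (12 * (J : ℝ)) := by
        rw [Finset.sum_const, Nat.card_Icc, nsmul_eq_mul]
        simp
    _ ≤ (ε * (L : ℝ) / (2 * Real.pi)) * (12 * (ε * (L : ℝ) / (2 * Real.pi))) := by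
        have hJ0 : (0 : ℝ) ≤ J := Nat.cast_nonneg J
        nlinarith
    _ = (3 / Real.pi ^ 2) * (ε ^ 2 * (L : ℝ) ^ 2) := by
        field_simp
        ring
    _ ≤ (1 / 3) * (ε ^ 2 * (L : ℝ) ^ 2) := by
        refine mul_le_mul_of_nonneg_right ?_ (by positivity)
        rw [div_le_div_iff₀ (by positivity) (by norm_num)]
        nlinarith
    _ = ε ^ 2 * (L : ℝ) ^ 2 / 3 := by ring

/-- **Pointwise step with background.** If `m ≠ 0` and
`S_ψ(m) · |q_m| · L² ≤ A · S_ψ(0) + B · |q_m| · L²`, then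
`S_ψ(m) ≤ (A · S_ψ(0) / L²) · |q_m|⁻¹ + B` (`|q_m| > 0` for `m ≠ 0`). [folklore] -/
theorem pairStructureFactor_le_of_shapeBg {L : ℕ} [NeZero L] (ψ : Fock (Orb (FermionTorus 2 L)))
    (A B : ℝ) {m : Fin 2 → ZMod L} (hm : m ≠ 0)
    (h : pairStructureFactor dWaveFormFactor L ψ m * Real.sqrt (momentumNormSq L m) * (L : ℝ) ^ 2 ≤
      A * pairStructureFactor dWaveFormFactor L ψ 0 +
        B * Real.sqrt (momentumNormSq L m) * (L : ℝ) ^ 2) :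
    pairStructureFactor dWaveFormFactor L ψ m ≤
      A * pairStructureFactor dWaveFormFactor L ψ 0 / (L : ℝ) ^ 2 *
        (1 / Real.sqrt (momentumNormSq L m)) + B := by
  have hL : (0 : ℝ) < (L : ℝ) := Nat.cast_pos.2 (Nat.pos_of_ne_zero (NeZero.ne L))
  have hL2 : (0 : ℝ) < (L : ℝ) ^ 2 := by positivity
  have hq : 0 < momentumNormSq L m :=
    lt_of_le_of_ne (momentumNormSq_nonneg m)
      (fun h0 => hm ((momentumNormSq_eq_zero_iff m).1 h0.symm))
  have hsq : 0 < Real.sqrt (momentumNormSq L m) := Real.sqrt_pos.2 hq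
  rw [← sub_le_iff_le_add, mul_one_div, le_div_iff₀ hsq, le_div_iff₀ hL2]
  nlinarith [h]

/-- **Arithmetic of skeleton v3 — the shape with background sums to the tail bound.** For every
side `L ≥ 1`, every Fock vector `ψ`, all `A, B ≥ 0` and every window radius `ε > 0`: if
`S_ψ(m) · |q_m| · L² ≤ A · S_ψ(0) + B · |q_m| · L²` for all `m ≠ 0` with `|q_m|² ≤ ε²`, then
`Σ_{m ≠ 0, |q_m|² ≤ ε²} S_ψ(m) ≤ 2Aε · S_ψ(0) + B ε² L²`. Proof: sum the pointwise step; the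
`|q_m|⁻¹`-part is `≤ (A S_ψ(0)/L²) · 2ε L²` by `latWindowSum_le` (radius `2ε`), the background part
is `≤ B · #window ≤ B ε² L² / 3 ≤ B ε² L²` by `card_softWindow_le`. No physics.
Kennedy–Lieb–Shastry, PRL 61 (1988) 2582 (lattice-sum bookkeeping). [folklore] -/
theorem softWindowTail_of_shapeBg :
    ∀ (L : ℕ) [NeZero L] (ψ : Fock (Orb (FermionTorus 2 L))) (A B ε : ℝ), 0 ≤ A → 0 ≤ B → 0 < ε →
      (∀ m : Fin 2 → ZMod L, m ≠ 0 → momentumNormSq L m ≤ ε ^ 2 →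
        pairStructureFactor dWaveFormFactor L ψ m * Real.sqrt (momentumNormSq L m) * (L : ℝ) ^ 2 ≤
          A * pairStructureFactor dWaveFormFactor L ψ 0 +
            B * Real.sqrt (momentumNormSq L m) * (L : ℝ) ^ 2) →
      ∑ m ∈ Finset.univ.filter
          (fun m : Fin 2 → ZMod L => m ≠ 0 ∧ momentumNormSq L m ≤ ε ^ 2),
        pairStructureFactor dWaveFormFactor L ψ m ≤
      2 * A * ε * pairStructureFactor dWaveFormFactor L ψ 0 + B * ε ^ 2 * (L : ℝ) ^ 2 := by
  intro L _ ψ A B ε hA hB hε hshape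
  have hL : (0 : ℝ) < (L : ℝ) := Nat.cast_pos.2 (Nat.pos_of_ne_zero (NeZero.ne L))
  have hL2 : (0 : ℝ) < (L : ℝ) ^ 2 := by positivity
  have hS0 : 0 ≤ pairStructureFactor dWaveFormFactor L ψ 0 := pairStructureFactor_nonneg _ _ _ _
  have hK : 0 ≤ A * pairStructureFactor dWaveFormFactor L ψ 0 / (L : ℝ) ^ 2 :=
    div_nonneg (mul_nonneg hA hS0) hL2.le
  set T : Finset (Fin 2 → ZMod L) :=
    Finset.univ.filter fun m : Fin 2 → ZMod L => m ≠ 0 ∧ momentumNormSq L m ≤ ε ^ 2 with hTdef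
  have hpt : ∀ m ∈ T, pairStructureFactor dWaveFormFactor L ψ m ≤
      A * pairStructureFactor dWaveFormFactor L ψ 0 / (L : ℝ) ^ 2 *
        (1 / Real.sqrt (momentumNormSq L m)) + B := by
    intro m hm
    obtain ⟨hm0, hmε⟩ := (Finset.mem_filter.1 hm).2
    exact pairStructureFactor_le_of_shapeBg ψ A B hm0 (hshape m hm0 hmε)
  have hsub : T ⊆ Finset.univ.filter
      (fun m : TorusSite 2 L => m ≠ 0 ∧ momentumNormSq L m < (2 * ε) ^ 2) := by
    intro m hm
    obtain ⟨hm0, hmε⟩ := (Finset.mem_filter.1 hm).2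
    refine Finset.mem_filter.2 ⟨Finset.mem_univ _, hm0, lt_of_le_of_lt hmε ?_⟩
    nlinarith
  have h2ε : 0 < 2 * ε := by positivity
  have hinv : ∑ m ∈ T, 1 / Real.sqrt (momentumNormSq L m) ≤ (2 * ε) * (L : ℝ) ^ 2 :=
    le_trans (Finset.sum_le_sum_of_subset_of_nonneg hsub (fun m _ _ => by positivity))
      (latWindowSum_le L (2 * ε) h2ε)
  have hcard : ((T.card : ℕ) : ℝ) ≤ ε ^ 2 * (L : ℝ) ^ 2 := by
    have h := card_softWindow_le L ε hε
    have h' : ε ^ 2 * (L : ℝ) ^ 2 / 3 ≤ ε ^ 2 * (L : ℝ) ^ 2 := by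
      rw [div_le_iff₀ (by norm_num : (0 : ℝ) < 3)]
      nlinarith [sq_nonneg (ε * (L : ℝ))]
    exact le_trans h h'
  calc ∑ m ∈ T, pairStructureFactor dWaveFormFactor L ψ m
      ≤ ∑ m ∈ T, (A * pairStructureFactor dWaveFormFactor L ψ 0 / (L : ℝ) ^ 2 *
          (1 / Real.sqrt (momentumNormSq L m)) + B) := Finset.sum_le_sum hpt
    _ = A * pairStructureFactor dWaveFormFactor L ψ 0 / (L : ℝ) ^ 2 *
          (∑ m ∈ T, 1 / Real.sqrt (momentumNormSq L m)) + ((T.card : ℕ) : ℝ) * B := by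
        rw [Finset.sum_add_distrib, Finset.mul_sum, Finset.sum_const, nsmul_eq_mul]
    _ ≤ A * pairStructureFactor dWaveFormFactor L ψ 0 / (L : ℝ) ^ 2 * ((2 * ε) * (L : ℝ) ^ 2) +
          (ε ^ 2 * (L : ℝ) ^ 2) * B :=
        add_le_add (mul_le_mul_of_nonneg_left hinv hK) (mul_le_mul_of_nonneg_right hcard hB)
    _ = 2 * A * ε * pairStructureFactor dWaveFormFactor L ψ 0 + B * ε ^ 2 * (L : ℝ) ^ 2 := by
        field_simp

end Summit.HubbardSuperconductivity.HubbardSuperconductivity.Theorems.InfraredCompletion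

end
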